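import Mathlib
import Literature.NumberTheory.EllipticCurves.IwasawaAlgebra

set_option linter.dupNamespace false
set_option autoImplicit false

/-!
# The a-type LIFT: K2 `ResidualNonvanishingSeven` at a b-type member from the first digit at the
# a-type member (sketch, kernel-checked algebra; bsd-idea-20 g57)

Crux workfile for `EllipticUnitValueSevenOfGZK` (stmt-BirchSwinnertonDyer-19945), research
statement K2 `ResidualNonvanishingSeven` (`z₀ ∉ (7)·𝐇¹`, file `KatoMuAbelianResidueSketch.lean`)
of card `Ideas/abelian-residue-mu-seven.md`; companion of memo `ATypeLift-g57.md` and of card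
`Ideas/first-layer-selmer-saturation.md` REV 3.  Planner bsd-idea-20 g57.  No summit statement,
crux or stub is proved here; the line of record `Lines/kato_perrin_riou_zp.lean` v9
(sha16 7f643694dfb0cab1) is untouched and nothing is re-registered (W-79).  Imports: Mathlib and
the Literature file defining `IwasawaAlgebra.augIdealP` only.  0 `sorry`.

## Dictionary (memo §2; all modules are modules over `R = Λ = ℤ₇⟦T⟧`, `p = 7 ∈ Λ`)

* `N = 𝐇¹(T_a)`, `T_a = T₇(E_{D,1})` the a-type lattice (top graded piece `ω²χ_D`, odd);
  `M = 𝐇¹(T_b)`, `T_b = T₇(E_{D,3})` the b-type lattice (top `ω⁵χ_D`, even);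
  `φ = 𝐇¹(φ_*) : N → M` induced by the `7`-isogeny `φ : E_{D,1} → E_{D,3}` (`φ_* T_a = π T_b ⊃ π² T_b = 7 T_b`).
* `hinj`  : `φ` injective (`H⁰(ℚ_∞, 𝔽₇(ω⁵χ_D)) = 0`).
* `hsand` : `7 • M ⊆ range φ` (multiplication by `7` on `T_b` factors through `φ_* T_a`; lemma
  `smul_mem_range_of_factor`).
* `hb`, `htf` : `M` free of rank one on `b` (tree `moduleFree_iwasawaH1_of_classCSeven` at the member
  `E_{D,3} ∈ 𝒞₇` + Kato Thm 12.4 (2)); `range φ` cyclic (same at `E_{D,1}`, lemma `range_eq_span_of_cyclic`).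
* `hfin`  : `M ⧸ range φ ↪ H¹_Iw(ℚ_∞, 𝔽₇(ω⁵χ_D))` is FINITE — memo g55 L2 (Ferrero–Washington for
  `ℚ(ζ₇, √D)` + Euler–Poincaré on an EVEN line); `hinf` : `M ⧸ 7M ≅ 𝔽₇⟦T⟧` is infinite.
  ⇒ `range_eq_top_of_finite_coker` : `range φ = ⊤`, i.e. memo g55 L3 `𝐇¹(π T_b) = 𝐇¹(T_b)` — the
  dichotomy `range_eq_top_or_eq_of_sandwich` («range = M or 7M») is the shape of Wuthrich 2014 Lemma 10.
* `P_N`, `P_M` : the layer-`m` Ĝ_a–Kurihara pairings `P_m^{E_{D,1}} ∘ pr`, `P_m^{E_{D,3}} ∘ pr` with values in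
  `A = ℤ₇[G_m]` (integral on integral classes: cup product + Weil pairing); `hscale` : `P_M ∘ φ = 7 • P_N`
  (Weil pairing `e₃(φa, φb) = e₁(a,b)⁷`, `log_{ω₃} ∘ φ = c_φ · log_{ω₁}`; STRUCTURALLY (S4) proves only
  `|c_φ| · Ω⁺(E_{D,1}) = 7 · Ω⁺(E_{D,3})`, i.e. `(c_φ, Ω⁺₁/Ω⁺₃) ∈ {(±1, 7), (±7, 1)}`; `|c_φ| = 1` is the
  OBSERVED branch (critic AGM 10/10, V#22bn/V#22br) and in the other branch the b-type member reads `μ = 0`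
  itself and needs no lift; memo §2 (S1)–(S4), §3).
* `hexact` : `P_M z = 7 • t` with `t = ε · e₀θ⁺_{7^m}(f_D; Ω⁺_Nér(E_{D,1}))` — ExactPairing at the b-type member
  (Kato Thm 12.5 (1) + Fourier inversion, memo g56 §8.7: `P_M z = ε θ_tw`, `θ_tw = 7 · θ(f_D; Ω⁺(E_{D,1}))`).
* `hdigit` : `t ∉ 7 • A` — the research input `DigitOne(D)` (μ(θ_tw) = 1 EXACTLY; 65/65 𝒞₇-type `D`, |D| ≤ 1367).
* Conclusion `k2_bType_of_digit` : `z ∉ (7) • M` = K2 at the b-type member; `k2_aType_of_digit` : the same at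
  the a-type member without `φ`; `blind_of_scaling` : `P_M(M) ⊆ 7A` — the structural form of g56's (T1)
  («first-digit functionals at the b-type member vanish identically»).
-/

open Pointwise

namespace Summit.BirchSwinnertonDyer.BirchSwinnertonDyer.Cruxes.EllipticUnitValueSevenOfGZK.ATypeLift

section membership

variable {R : Type*} [CommRing R] {M : Type*} [AddCommGroup M] [Module R M]

/-- Bridge between the crux's currency `x ∈ (p) • ⊤` (ideal times submodule, as in
`ResidualNonvanishingSeven`: `z₀ ∉ augIdealP 7 • ⊤`) and plain `p`-divisibility. -/
theorem mem_span_singleton_smul_top_iff (p : R) (x : M) :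
    x ∈ (Ideal.span {p} : Ideal R) • (⊤ : Submodule R M) ↔ ∃ w : M, x = p • w := by
  rw [Submodule.ideal_span_singleton_smul, Submodule.mem_smul_pointwise_iff_exists]
  constructor
  · rintro ⟨b, -, rfl⟩
    exact ⟨b, rfl⟩
  · rintro ⟨w, rfl⟩
    exact ⟨w, Submodule.mem_top, rfl⟩

end membership

section lift

variable {R : Type*} [CommRing R] {N M : Type*} [AddCommGroup N] [Module R N]
  [AddCommGroup M] [Module R M]

/-- DOWN the lift: if `φ` is injective with `range φ = ⊤` (memo g55 L3) and `φ w` is `p`-divisible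
in `M`, then `w` is `p`-divisible in `N`.  The hypothesis `range φ = ⊤` is exactly where the even
top piece / Ferrero–Washington enter. -/
theorem exists_eq_smul_of_lift (φ : N →ₗ[R] M) (hinj : Function.Injective φ)
    (hrange : LinearMap.range φ = ⊤) {p : R} {w : N} (h : ∃ u : M, φ w = p • u) :
    ∃ v : N, w = p • v := by
  obtain ⟨u, hu⟩ := h
  have hu' : u ∈ LinearMap.range φ := by
    rw [hrange]
    exact Submodule.mem_top
  obtain ⟨v, rfl⟩ := LinearMap.mem_range.mp hu'
  exact ⟨v, hinj (by rw [hu, map_smul])⟩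

/-- UP the lift (no hypothesis on `φ`). -/
theorem exists_eq_smul_map_of (φ : N →ₗ[R] M) {p : R} {w : N} (h : ∃ v : N, w = p • v) :
    ∃ u : M, φ w = p • u := by
  obtain ⟨v, rfl⟩ := h
  exact ⟨φ v, map_smul φ p v⟩

/-- K2 is TRANSPORTED along the lift: under L3, `φ w ∈ (p)•M ↔ w ∈ (p)•N`.  With `N = 𝐇¹(T₇E_{D,1})`,
`M = 𝐇¹(T₇E_{D,3})`: K2 at the b-type member ⟺ K2 at the a-type member, for the classes `z = φ w`. -/
theorem mem_smul_top_map_iff (φ : N →ₗ[R] M) (hinj : Function.Injective φ)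
    (hrange : LinearMap.range φ = ⊤) (p : R) (w : N) :
    φ w ∈ (Ideal.span {p} : Ideal R) • (⊤ : Submodule R M) ↔
      w ∈ (Ideal.span {p} : Ideal R) • (⊤ : Submodule R N) := by
  rw [mem_span_singleton_smul_top_iff, mem_span_singleton_smul_top_iff]
  exact ⟨exists_eq_smul_of_lift φ hinj hrange, exists_eq_smul_map_of φ⟩

end lift

section evenStep

variable {R : Type*} [CommRing R] {N M : Type*} [AddCommGroup N] [Module R N]
  [AddCommGroup M] [Module R M]

/-- The SANDWICH `p • M ⊆ range φ`: multiplication by `p` on `M` factors through `φ` (on lattices: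
`7·T_b = π²T_b ⊆ πT_b = φ_*T_a`). -/
theorem smul_mem_range_of_factor (φ : N →ₗ[R] M) (ψ : M →ₗ[R] N) (p : R)
    (hfac : φ ∘ₗ ψ = p • LinearMap.id) (m : M) : p • m ∈ LinearMap.range φ :=
  LinearMap.mem_range.mpr ⟨ψ m, by rw [← LinearMap.comp_apply, hfac]; rfl⟩

/-- The range of a map out of a CYCLIC module into a rank-one free module `M = R·b` is `R·(f b)`
for some `f ∈ R` (both `𝐇¹`'s are free of rank one on `𝒞₇`: tree `moduleFree_iwasawaH1_of_classCSeven`). -/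
theorem range_eq_span_of_cyclic (φ : N →ₗ[R] M) (n : N) (hn : Submodule.span R {n} = ⊤) (b : M)
    (hb : Submodule.span R {b} = ⊤) : ∃ f : R, LinearMap.range φ = Submodule.span R {f • b} := by
  have hmem : φ n ∈ Submodule.span R {b} := by
    rw [hb]
    exact Submodule.mem_top
  obtain ⟨f, hf⟩ := Submodule.mem_span_singleton.mp hmem
  refine ⟨f, ?_⟩
  rw [LinearMap.range_eq_map, ← hn, Submodule.map_span, Set.image_singleton, hf]

/-- **DICHOTOMY (the shape of Wuthrich 2014, Lemma 10): `range φ = M` or `range φ = p·M`.**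
`M` free of rank one on `b`, `range φ = R·(f b)` cyclic, sandwich `p • b ∈ range φ`, `p` prime:
then `f ∣ p`, so `f` is a unit or an associate of `p`. -/
theorem range_eq_top_or_eq_of_sandwich [IsDomain R] (φ : N →ₗ[R] M) (b : M)
    (hb : Submodule.span R {b} = ⊤) (htf : ∀ r : R, r • b = 0 → r = 0) (f : R)
    (hf : LinearMap.range φ = Submodule.span R {f • b}) {p : R} (hp : Prime p)
    (hsand : p • b ∈ LinearMap.range φ) :
    LinearMap.range φ = ⊤ ∨ LinearMap.range φ = Submodule.span R {p • b} := by
  rw [hf] at hsand ⊢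
  obtain ⟨r, hr⟩ := Submodule.mem_span_singleton.mp hsand
  have hrf : r * f = p := by
    have h0 : (r * f - p) • b = 0 := by rw [sub_smul, mul_smul, hr, sub_self]
    exact sub_eq_zero.mp (htf _ h0)
  have hdvd : p ∣ r * f := ⟨1, by rw [mul_one]; exact hrf⟩
  rcases hp.dvd_or_dvd hdvd with ⟨s, hs⟩ | ⟨s, hs⟩
  · left
    have hsf : s * f = 1 := by
      apply mul_left_cancel₀ hp.ne_zero
      rw [← mul_assoc, ← hs, hrf, mul_one]
    rw [Submodule.span_singleton_smul_eq (IsUnit.of_mul_eq_one_right s hsf), hb]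
  · right
    have hrs : r * s = 1 := by
      apply mul_left_cancel₀ hp.ne_zero
      calc p * (r * s) = r * (p * s) := by ring
        _ = r * f := by rw [hs]
        _ = p := hrf
        _ = p * 1 := (mul_one p).symm
    have hfb : f • b = s • (p • b) := by rw [hs, smul_smul, mul_comm s p]
    rw [hfb, Submodule.span_singleton_smul_eq (IsUnit.of_mul_eq_one_right r hrs)]

/-- **L3, kernel form: an EVEN step is an equality.**  In the dichotomy, a FINITE cokernel
(`M ⧸ range φ ↪ H¹_Iw(ℚ_∞, 𝔽₇(ω⁵χ_D))`, finite by Ferrero–Washington on the even line, memo g55 L2)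
excludes `range φ = p·M` because `M ⧸ p·M ≅ Λ/7 = 𝔽₇⟦T⟧` is infinite.  Hence `range φ = ⊤`:
`𝐇¹(φ_*T_a) = 𝐇¹(T_b)`. -/
theorem range_eq_top_of_finite_coker [IsDomain R] (φ : N →ₗ[R] M) (b : M)
    (hb : Submodule.span R {b} = ⊤) (htf : ∀ r : R, r • b = 0 → r = 0) (f : R)
    (hf : LinearMap.range φ = Submodule.span R {f • b}) {p : R} (hp : Prime p)
    (hsand : p • b ∈ LinearMap.range φ) (hfin : Finite (M ⧸ LinearMap.range φ))
    (hinf : Infinite (M ⧸ Submodule.span R {p • b})) : LinearMap.range φ = ⊤ := by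
  rcases range_eq_top_or_eq_of_sandwich φ b hb htf f hf hp hsand with h | h
  · exact h
  · exfalso
    rw [h] at hfin
    haveI := hfin
    exact not_finite (M ⧸ Submodule.span R {p • b})

end evenStep

section scaling

variable {R : Type*} [CommRing R] {N M A : Type*} [AddCommGroup N] [Module R N]
  [AddCommGroup M] [Module R M] [AddCommGroup A] [Module R A]

/-- **STRUCTURAL BLINDNESS at the b-type member** (second proof of g56 (T1) «θ_tw ∈ 7ℤ₇[G_m]»):
if the pairings scale by `p` under the isogeny (`P_M ∘ φ = p • P_N`) and `range φ = ⊤` (L3), then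
the b-member's functional is divisible by `p` on ALL of `M`. Reading Kato's class there is blind. -/
theorem blind_of_scaling (φ : N →ₗ[R] M) (hrange : LinearMap.range φ = ⊤) (P_N : N →ₗ[R] A)
    (P_M : M →ₗ[R] A) (p : R) (hscale : P_M ∘ₗ φ = p • P_N) (m : M) :
    ∃ a : A, P_M m = p • a := by
  have hm : m ∈ LinearMap.range φ := by
    rw [hrange]
    exact Submodule.mem_top
  obtain ⟨w, rfl⟩ := LinearMap.mem_range.mp hm
  exact ⟨P_N w, by rw [← LinearMap.comp_apply, hscale, LinearMap.smul_apply]⟩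

/-- An INTEGRAL functional detects `p`-divisibility (g56 `not_exists_eq_smul_of_not_dvd`, `R`-linear
form): if `P w ∉ p•A` then `w ∉ p•N`. -/
theorem not_exists_eq_smul_of_apply (P : N →ₗ[R] A) (p : R) (w : N)
    (h : ¬ ∃ a : A, P w = p • a) : ¬ ∃ v : N, w = p • v := by
  rintro ⟨v, rfl⟩
  exact h ⟨P v, map_smul P p v⟩

/-- **LIFT VALUE**: the a-member reading of the lifted class is the b-member reading divided by `p`:
from `P_M (φ w) = p • t` and `P_M ∘ φ = p • P_N` in a `p`-torsion-free `A` (= `ℤ₇[G_m]`), `P_N w = t`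
(memo: `P₂^{E_{D,1}}(w₂) = ε θ_tw / 7 = ε·e₀θ₄₉(f_D; Ω⁺_Nér(E_{D,1}))`). -/
theorem lift_value (φ : N →ₗ[R] M) (P_N : N →ₗ[R] A) (P_M : M →ₗ[R] A) (p : R)
    (hscale : P_M ∘ₗ φ = p • P_N) (htors : ∀ a : A, p • a = 0 → a = 0) {w : N} {t : A}
    (ht : P_M (φ w) = p • t) : P_N w = t := by
  have h1 : p • P_N w = p • t := by
    rw [← LinearMap.smul_apply, ← hscale, LinearMap.comp_apply, ht]
  have h0 : p • (P_N w - t) = 0 := by rw [smul_sub, h1, sub_self]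
  exact sub_eq_zero.mp (htors _ h0)

end scaling

section composition

variable {R : Type*} [CommRing R] {N M A : Type*} [AddCommGroup N] [Module R N]
  [AddCommGroup M] [Module R M] [AddCommGroup A] [Module R A]

/-- **K2 AT AN a-TYPE MEMBER from the first digit** (card REV 2's a1-side chain, now for every `D`):
an admissible class `w` of an a-type member pairs to `t = ε·e₀θ⁺_{7^m}(f_D; Ω⁺_Nér(E_{D,1}))`
(`hexact`); if `t ∉ 7•ℤ₇[G_m]` (`DigitOne(D)`), then `w ∉ (7)•𝐇¹(T_a)`. -/
theorem k2_aType_of_digit (P_N : N →ₗ[R] A) (p : R) (w : N) (t : A) (hexact : P_N w = t)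
    (hdigit : ¬ ∃ a : A, t = p • a) :
    w ∉ (Ideal.span {p} : Ideal R) • (⊤ : Submodule R N) := by
  rw [mem_span_singleton_smul_top_iff]
  refine not_exists_eq_smul_of_apply P_N p w ?_
  rw [hexact]
  exact hdigit

/-- **K2 AT A b-TYPE MEMBER from the first digit at the a-TYPE member — the a-type LIFT.**
`z ∈ M = 𝐇¹(T_b)` admissible (Kato's own class on the a3-side of 𝒞₇), `P_M z = 7 • t` (ExactPairing at
the b-member: `ε θ_tw`, `μ = 1` — blind there), `range φ = ⊤` and `φ` injective (L3), `P_M ∘ φ = 7 • P_N`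
(Weil-pairing scaling, `c_φ = ±1`), `ℤ₇[G_m]` torsion-free, and `t ∉ 7•ℤ₇[G_m]` (`DigitOne(D)`): then
`z ∉ (7)•𝐇¹(T_b)`.  This un-blinds the a3-side (85 of the 132 classes |D| ≤ 3000). -/
theorem k2_bType_of_digit (φ : N →ₗ[R] M) (hinj : Function.Injective φ)
    (hrange : LinearMap.range φ = ⊤) (P_N : N →ₗ[R] A) (P_M : M →ₗ[R] A) (p : R)
    (hscale : P_M ∘ₗ φ = p • P_N) (htors : ∀ a : A, p • a = 0 → a = 0) (z : M) (t : A)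
    (hexact : P_M z = p • t) (hdigit : ¬ ∃ a : A, t = p • a) :
    z ∉ (Ideal.span {p} : Ideal R) • (⊤ : Submodule R M) := by
  have hz : z ∈ LinearMap.range φ := by
    rw [hrange]
    exact Submodule.mem_top
  obtain ⟨w, rfl⟩ := LinearMap.mem_range.mp hz
  have hval : P_N w = t := lift_value φ P_N P_M p hscale htors hexact
  rw [mem_smul_top_map_iff φ hinj hrange]
  exact k2_aType_of_digit P_N p w t hval hdigit

/-- The same with L3 DERIVED from its inputs (dichotomy + finite cokernel) rather than assumed. -/
theorem k2_bType_of_digit_of_inputs [IsDomain R] (φ : N →ₗ[R] M) (hinj : Function.Injective φ)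
    (b : M) (hb : Submodule.span R {b} = ⊤) (htf : ∀ r : R, r • b = 0 → r = 0)
    (n : N) (hn : Submodule.span R {n} = ⊤) (ψ : M →ₗ[R] N) {p : R} (hp : Prime p)
    (hfac : φ ∘ₗ ψ = p • LinearMap.id) (hfin : Finite (M ⧸ LinearMap.range φ))
    (hinf : Infinite (M ⧸ Submodule.span R {p • b}))
    (P_N : N →ₗ[R] A) (P_M : M →ₗ[R] A) (hscale : P_M ∘ₗ φ = p • P_N)
    (htors : ∀ a : A, p • a = 0 → a = 0) (z : M) (t : A) (hexact : P_M z = p • t)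
    (hdigit : ¬ ∃ a : A, t = p • a) :
    z ∉ (Ideal.span {p} : Ideal R) • (⊤ : Submodule R M) := by
  obtain ⟨f, hf⟩ := range_eq_span_of_cyclic φ n hn b hb
  have hrange : LinearMap.range φ = ⊤ :=
    range_eq_top_of_finite_coker φ b hb htf f hf hp (smul_mem_range_of_factor φ ψ p hfac b)
      hfin hinf
  exact k2_bType_of_digit φ hinj hrange P_N P_M p hscale htors z t hexact hdigit

end composition

section treeCurrency

open Literature.NumberTheory.EllipticCurves Literature.NumberTheory.EllipticCurves.IwasawaAlgebra

/-- The crux's literal currency: `x ∈ augIdealP 7 • ⊤` (as in `ResidualNonvanishingSeven`) iff `x` is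
`7`-divisible in the `Λ`-module (`7 = PowerSeries.C 7 ∈ Λ = ℤ₇⟦T⟧`). -/
theorem mem_augIdealP_smul_top_iff [Fact (Nat.Prime 7)] {H : Type*} [AddCommGroup H]
    [Module (IwasawaAlgebra 7) H] (x : H) :
    x ∈ (augIdealP 7 • (⊤ : Submodule (IwasawaAlgebra 7) H)) ↔
      ∃ w : H, x = (PowerSeries.C (7 : ℤ_[7]) : IwasawaAlgebra 7) • w := by
  show x ∈ (Ideal.span {PowerSeries.C (7 : ℤ_[7])} : Ideal (IwasawaAlgebra 7)) • ⊤ ↔ _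
  exact mem_span_singleton_smul_top_iff _ x

/-- **The a-type lift in the crux's currency** (`Λ = IwasawaAlgebra 7`, `(7) = augIdealP 7`):
`N = 𝐇¹(T₇E_{D,1})`, `M = 𝐇¹(T₇E_{D,3})`, `φ = 𝐇¹(φ_*)` with `range φ = ⊤` (L3), pairings scaling by `7`,
ExactPairing `P_M z = 7 • t` at the b-member and `DigitOne` `t ∉ 7 • A` ⟹ `z ∉ augIdealP 7 • ⊤`, the
conclusion of `ResidualNonvanishingSeven` for the member `E_{D,3}` and the class `z`. -/
theorem k2_bType_of_digit_seven [Fact (Nat.Prime 7)] {N M A : Type*} [AddCommGroup N]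
    [Module (IwasawaAlgebra 7) N] [AddCommGroup M] [Module (IwasawaAlgebra 7) M] [AddCommGroup A]
    [Module (IwasawaAlgebra 7) A] (φ : N →ₗ[IwasawaAlgebra 7] M) (hinj : Function.Injective φ)
    (hrange : LinearMap.range φ = ⊤) (P_N : N →ₗ[IwasawaAlgebra 7] A)
    (P_M : M →ₗ[IwasawaAlgebra 7] A)
    (hscale : P_M ∘ₗ φ = (PowerSeries.C (7 : ℤ_[7]) : IwasawaAlgebra 7) • P_N)
    (htors : ∀ a : A, (PowerSeries.C (7 : ℤ_[7]) : IwasawaAlgebra 7) • a = 0 → a = 0)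
    (z : M) (t : A) (hexact : P_M z = (PowerSeries.C (7 : ℤ_[7]) : IwasawaAlgebra 7) • t)
    (hdigit : ¬ ∃ a : A, t = (PowerSeries.C (7 : ℤ_[7]) : IwasawaAlgebra 7) • a) :
    z ∉ (augIdealP 7 • (⊤ : Submodule (IwasawaAlgebra 7) M)) := by
  show z ∉ (Ideal.span {PowerSeries.C (7 : ℤ_[7])} : Ideal (IwasawaAlgebra 7)) • ⊤
  exact k2_bType_of_digit φ hinj hrange P_N P_M _ hscale htors z t hexact hdigit

/-- … and at an a-type member (`N = 𝐇¹(T₇E_{D,1})`), no lift needed. -/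
theorem k2_aType_of_digit_seven [Fact (Nat.Prime 7)] {N A : Type*} [AddCommGroup N]
    [Module (IwasawaAlgebra 7) N] [AddCommGroup A] [Module (IwasawaAlgebra 7) A]
    (P_N : N →ₗ[IwasawaAlgebra 7] A) (w : N) (t : A) (hexact : P_N w = t)
    (hdigit : ¬ ∃ a : A, t = (PowerSeries.C (7 : ℤ_[7]) : IwasawaAlgebra 7) • a) :
    w ∉ (augIdealP 7 • (⊤ : Submodule (IwasawaAlgebra 7) N)) := by
  show w ∉ (Ideal.span {PowerSeries.C (7 : ℤ_[7])} : Ideal (IwasawaAlgebra 7)) • ⊤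
  exact k2_aType_of_digit P_N _ w t hexact hdigit

end treeCurrency

end Summit.BirchSwinnertonDyer.BirchSwinnertonDyer.Cruxes.EllipticUnitValueSevenOfGZK.ATypeLift
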